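import Literature.Probability.Moments.HerbstArgument
import Literature.MathematicalPhysics.QuantumFieldTheory.Balaban1983to89.T3UnitScaleTilt
import Literature.MathematicalPhysics.QuantumFieldTheory.Balaban1983to89.T4PairDerivBridge
import HarnessLib

/-!
# Crux `HistoryTailL` (stmt-QuantumFields-19936), line #12 organ K1 — THE HERBST DOOR:
# `MesoscopicConcentrationL` ⟸ an entropy bound for `e^{lf}` at the Hodge–Poincaré scale `n²Λ²∕β_K`

Cell `ym3-torus` (YM ladder rung R3 = continuum SU(2) Yang–Mills on the 3-torus — NOT d = 4, NOT infinite volume, NOT a mass gap, NOT the Clay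
problem), width seat `ym-ust-19936-w4` gen 12; companion of the located memo `K1-MESOSCOPIC-LOCATE-w4g12.md` (19936 evidence #46) §2–§3:
«K1 = a LOCAL log-Sobolev ∕ Herbst statement for the full torus law `gibbsK` on box-local gauge-invariant observables at the box's Hodge–Poincaré
scale `n²∕β_K`».  `--supports stmt-QuantumFields-19936 --as helper`.

WHAT THIS FILE PROVES (a door, M): the text of the deciding crux `PoincareLipschitz.MesoscopicConcentrationL` (stmt-QuantumFields-23532 — NOT
claimed, NOT restated as a definition, NOT proved; its body is written out VERBATIM as the conclusion, so this module stays outside the theses cone)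
follows, with `Cc = 1` and `cc = 1∕(4·cE)`, from ONE displayed functional-inequality hypothesis `hEnt` on exactly the crux's class of observables:

  for every box-local, gauge-invariant, measurable, `Λ`-Lipschitz (`ℓ²` link metric) `f` and every real `l`,
  `Ent_{gibbsK}(e^{lf}) = ∫ e^{lf}·lf − (∫ e^{lf})·log ∫ e^{lf} ≤ cE·(n²Λ²∕β_K)·l²·∫ e^{lf}`

— the already-integrated form in which a logarithmic Sobolev inequality for `gibbsK` with constant `≍ n²∕β_K` on that class (and `|∇f| ≤ Λ`) is
consumed by Herbst's argument; the probabilistic step is the tree's ✓`Literature.Probability.Moments.herbst_laplace_and_tail_bound`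
(Bakry–Gentil–Ledoux Prop. 5.4.1, kernel-proved), applicable because every `f` of the class is bounded (`|f U − f 1| ≤ 2Λ√#bonds`, from the
Lipschitz hypothesis at `U' = 1` and `dist1 ≤ 2` on `SU(2)`).

* `abs_sub_one_le_of_lipschitz`, `abs_le_of_lipschitz` — the boundedness of the class;
* ★★`mesoscopicConcentrationL_of_entropyBound (hEnt) : ⟨text of MesoscopicConcentrationL⟩`.

HONEST: a DOOR — it moves the organ K1 to its canonical functional-inequality face (`hEnt`, the entropy bound at the Hodge scale, uniform in the
torus side and in `n ≤ β_K`); `hEnt` is OPEN (no log-Sobolev ∕ spectral-gap statement for a continuous gauge group at weak coupling exists in print —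
Shen–Zhu–Zhu's Bakry–Émery LSI [arXiv:2204.12737, Assumption 1.1] is strong coupling `|β| < 1∕32` only); nothing of K1, the stubs, the crux or
`HistoryTailL` is proved here.  THEOREMS ONLY, definition-free.
[cite: BakryGentilLedoux2014, Prop. 5.4.1; Balaban1985UV3, (3) p.256]
-/

set_option autoImplicit false

noncomputable section

open scoped BigOperators
open MeasureTheory
open Literature.MathematicalPhysics.QuantumFieldTheory
open Literature.MathematicalPhysics.QuantumFieldTheory.Balaban1983to89
open Literature.MathematicalPhysics.QuantumFieldTheory.Balaban1983to89.T3ContinuumYM3Torus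
open Literature.MathematicalPhysics.QuantumFieldTheory.Balaban1983to89.T3UnitScaleTilt
open Literature.MathematicalPhysics.QuantumFieldTheory.Balaban1983to89.T3UnitLawDensityEML
open Literature.MathematicalPhysics.QuantumFieldTheory.Balaban1983to89.T4PairDerivBridge (dist1_le_two_specialUnitaryGroup)

namespace Summit.QuantumFields.YangMills.Theorems.PoincareLipschitzMesoscopicConcentrationOfEntropy

/-! ## §1 Every observable of the K1 class is bounded -/

/-- A function that is `Λ`-Lipschitz (`Λ ≥ 0`) in the `ℓ²` link metric `√(Σ_b dist1(U_b U'_b⁻¹)²)` on `SU(2)` gauge fields over a finite bond set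
is within `Λ·√(Σ_b 2²)` of its value at the trivial field (`dist1 ≤ 2` on `SU(2)`). [folklore] -/
theorem abs_sub_one_le_of_lipschitz {P : Params}
    (f : GaugeField P 0 (Matrix.specialUnitaryGroup (Fin 2) ℂ) → ℝ) {Λ : ℝ} (hΛ : 0 ≤ Λ)
    (hLip : ∀ U U' : GaugeField P 0 (Matrix.specialUnitaryGroup (Fin 2) ℂ),
      |f U - f U'| ≤ Λ * Real.sqrt (∑ b : PBond P 0, GaugeGroup.dist1 (U b * (U' b)⁻¹) ^ 2))
    (U : GaugeField P 0 (Matrix.specialUnitaryGroup (Fin 2) ℂ)) :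
    |f U - f 1| ≤ Λ * Real.sqrt (∑ _b : PBond P 0, (2 : ℝ) ^ 2) := by
  have h1 := hLip U 1
  have h2 : Real.sqrt (∑ b : PBond P 0, GaugeGroup.dist1 (U b * ((1 : GaugeField P 0 _) b)⁻¹) ^ 2) ≤
      Real.sqrt (∑ _b : PBond P 0, (2 : ℝ) ^ 2) := by
    refine Real.sqrt_le_sqrt (Finset.sum_le_sum fun b _ => ?_)
    exact pow_le_pow_left₀ (GaugeGroup.dist1_nonneg _) (dist1_le_two_specialUnitaryGroup _) 2
  exact h1.trans (mul_le_mul_of_nonneg_left h2 hΛ)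

/-- Hence `|f| ≤ |f 1| + Λ·√(Σ_b 2²)` pointwise: the K1 class consists of bounded observables. [folklore] -/
theorem abs_le_of_lipschitz {P : Params}
    (f : GaugeField P 0 (Matrix.specialUnitaryGroup (Fin 2) ℂ) → ℝ) {Λ : ℝ} (hΛ : 0 ≤ Λ)
    (hLip : ∀ U U' : GaugeField P 0 (Matrix.specialUnitaryGroup (Fin 2) ℂ),
      |f U - f U'| ≤ Λ * Real.sqrt (∑ b : PBond P 0, GaugeGroup.dist1 (U b * (U' b)⁻¹) ^ 2))
    (U : GaugeField P 0 (Matrix.specialUnitaryGroup (Fin 2) ℂ)) :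
    |f U| ≤ |f 1| + Λ * Real.sqrt (∑ _b : PBond P 0, (2 : ℝ) ^ 2) := by
  have h := abs_sub_one_le_of_lipschitz f hΛ hLip U
  have := abs_sub_abs_le_abs_sub (f U) (f 1)
  linarith

/-! ## §2 The Herbst door -/

/-- ★★ **`MesoscopicConcentrationL` ⟸ THE ENTROPY BOUND AT THE HODGE–POINCARÉ SCALE (Herbst's argument).**  Suppose that for every `L` there are
`cE > 0` and `γ₁ ∈ (0,1]` such that for every `T3Family F` with `F.L = L`, every `γ ∈ (0,γ₁]`, every `K`, every box side `1 ≤ n ≤ β_K` with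
`2n ≤ sitesPerDir`, every corner `x₀`, every measurable gauge-invariant `f` depending only on the bonds of the box `x₀ + [0,n)³` and `Λ`-Lipschitz
(`Λ > 0`) in the `ℓ²` link metric, and every real `l`:
`∫ e^{lf}·(lf) d gibbsK − (∫ e^{lf} d gibbsK)·log(∫ e^{lf} d gibbsK) ≤ cE·(n²Λ²∕β_K)·l²·∫ e^{lf} d gibbsK`
(what a log-Sobolev inequality for `gibbsK` with constant `≍ n²∕β_K` on this class gives for `e^{lf∕2}`, `|∇f| ≤ Λ`).  THEN the text of the deciding
crux `PoincareLipschitz.MesoscopicConcentrationL` holds with `Cc = 1`, `cc = 1∕(4cE)` and the same `γ₁`: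
`gibbsK{r ≤ f − ∫f} ≤ 1·exp(−(1∕(4cE))·β_K·r²∕(n²Λ²))`.  Proof: the class is bounded (§1), so the tree's kernel-proved Herbst argument
✓`Literature.Probability.Moments.herbst_laplace_and_tail_bound` applies with `c := cE·n²Λ²∕β_K`.  A DOOR: `hEnt` is the organ K1 in its
functional-inequality form and is NOT proved. [cite: BakryGentilLedoux2014, Prop. 5.4.1] -/
theorem mesoscopicConcentrationL_of_entropyBound
    (hEnt : ∀ (L : ℕ), ∃ cE : ℝ, 0 < cE ∧ ∃ γ₁ : ℝ, 0 < γ₁ ∧ γ₁ ≤ 1 ∧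
      ∀ (F : T3Family) (γ : ℝ), F.L = L → 0 < γ → γ ≤ γ₁ → ∀ (K n : ℕ), 1 ≤ n →
        (n : ℝ) ≤ (F.scheme ℰp γ).β K → 2 * n ≤ (F.P K).sitesPerDir 0 →
        ∀ (x₀ : Site (F.P K) 0) (f : GaugeField (F.P K) 0 (Matrix.specialUnitaryGroup (Fin 2) ℂ) → ℝ) (Λ : ℝ), 0 < Λ →
          Measurable f → GaugeField.GaugeInvariant f →
          (∀ U U' : GaugeField (F.P K) 0 (Matrix.specialUnitaryGroup (Fin 2) ℂ),
            (∀ b : PBond (F.P K) 0, (∀ k, (b.src k - x₀ k).val < n) → (∀ k, (b.tgt k - x₀ k).val < n) → U b = U' b) →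
              f U = f U') →
          (∀ U U' : GaugeField (F.P K) 0 (Matrix.specialUnitaryGroup (Fin 2) ℂ),
            |f U - f U'| ≤ Λ * Real.sqrt (∑ b : PBond (F.P K) 0, GaugeGroup.dist1 (U b * (U' b)⁻¹) ^ 2)) →
          ∀ l : ℝ,
            ∫ U, Real.exp (l * f U) * (l * f U) ∂(gibbsK F ℰp γ K) -
                (∫ U, Real.exp (l * f U) ∂(gibbsK F ℰp γ K)) * Real.log (∫ U, Real.exp (l * f U) ∂(gibbsK F ℰp γ K)) ≤
              cE * ((n : ℝ) ^ 2 * Λ ^ 2 / (F.scheme ℰp γ).β K) * l ^ 2 * ∫ U, Real.exp (l * f U) ∂(gibbsK F ℰp γ K)) :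
    ∀ (L : ℕ), ∃ (Cc cc : ℝ), 0 ≤ Cc ∧ 0 < cc ∧ ∃ γ₁ : ℝ, 0 < γ₁ ∧ γ₁ ≤ 1 ∧
      ∀ (F : T3Family) (γ : ℝ), F.L = L → 0 < γ → γ ≤ γ₁ → ∀ (K n : ℕ), 1 ≤ n →
        (n : ℝ) ≤ (F.scheme ℰp γ).β K → 2 * n ≤ (F.P K).sitesPerDir 0 →
        ∀ (x₀ : Site (F.P K) 0) (f : GaugeField (F.P K) 0 (Matrix.specialUnitaryGroup (Fin 2) ℂ) → ℝ) (Λ : ℝ), 0 < Λ →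
          Measurable f → GaugeField.GaugeInvariant f →
          (∀ U U' : GaugeField (F.P K) 0 (Matrix.specialUnitaryGroup (Fin 2) ℂ),
            (∀ b : PBond (F.P K) 0, (∀ k, (b.src k - x₀ k).val < n) → (∀ k, (b.tgt k - x₀ k).val < n) → U b = U' b) →
              f U = f U') →
          (∀ U U' : GaugeField (F.P K) 0 (Matrix.specialUnitaryGroup (Fin 2) ℂ),
            |f U - f U'| ≤ Λ * Real.sqrt (∑ b : PBond (F.P K) 0, GaugeGroup.dist1 (U b * (U' b)⁻¹) ^ 2)) →
          ∀ r : ℝ, 0 ≤ r →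
            (gibbsK F ℰp γ K).real {U | r ≤ f U - ∫ V, f V ∂(gibbsK F ℰp γ K)} ≤
              Cc * Real.exp (-(cc * (F.scheme ℰp γ).β K * r ^ 2 / ((n : ℝ) ^ 2 * Λ ^ 2))) := by
  intro L
  obtain ⟨cE, hcE, γ₁, hγ₁, hγ₁1, H⟩ := hEnt L
  refine ⟨1, 1 / (4 * cE), zero_le_one, by positivity, γ₁, hγ₁, hγ₁1, ?_⟩
  intro F γ hFL hγ hγ₁' K n hn hnβ h2n x₀ f Λ hΛ hfm hinv hloc hLip r hr
  haveI := isProbabilityMeasure_gibbsK F ℰp hγ.le K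
  set μ := gibbsK F ℰp γ K with hμ
  set β : ℝ := (F.scheme ℰp γ).β K with hβ
  have hn0 : (0 : ℝ) < (n : ℝ) := by exact_mod_cast (Nat.lt_of_lt_of_le Nat.zero_lt_one hn)
  have hβ0 : 0 < β := by
    have hβe : β = (γ * (F.P K).eps)⁻¹ := rfl
    rw [hβe]
    exact inv_pos.2 (mul_pos hγ (F.P K).eps_pos)
  -- the Herbst constant at the Hodge–Poincaré scale
  set c : ℝ := cE * ((n : ℝ) ^ 2 * Λ ^ 2 / β) with hc
  have hc0 : 0 < c := by positivity
  have hbdd : ∃ C : ℝ, ∀ U, |f U| ≤ C :=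
    ⟨|f 1| + Λ * Real.sqrt (∑ _b : PBond (F.P K) 0, (2 : ℝ) ^ 2), abs_le_of_lipschitz f hΛ.le hLip⟩
  have hEnt' : ∀ l : ℝ, ∫ U, Real.exp (l * f U) * (l * f U) ∂μ -
      (∫ U, Real.exp (l * f U) ∂μ) * Real.log (∫ U, Real.exp (l * f U) ∂μ) ≤ c * l ^ 2 * ∫ U, Real.exp (l * f U) ∂μ := by
    intro l
    rw [hμ, hc, hβ]
    exact H F γ hFL hγ hγ₁' K n hn hnβ h2n x₀ f Λ hΛ hfm hinv hloc hLip l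
  have htail := (Literature.Probability.Moments.herbst_laplace_and_tail_bound μ hfm hbdd hc0 hEnt').2 r hr
  refine htail.trans (le_of_eq ?_)
  rw [one_mul]
  congr 1
  rw [hc]
  field_simp

end Summit.QuantumFields.YangMills.Theorems.PoincareLipschitzMesoscopicConcentrationOfEntropy

end
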